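import Summits.RiemannHypothesis.RiemannHypothesis.Theorems.WeilColumnCeilings
import Summits.RiemannHypothesis.RiemannHypothesis.Theorems.HandoffDodgerCeilingTheorem
import Summits.RiemannHypothesis.RiemannHypothesis.Theorems.SemilocalClassLawLeaves
import HarnessLib

/-!
# WEIL column — the W-P(P1-type) RUNG LEAF `SemilocalDodgerCeiling` DISCHARGED, and the C-I(a) TAIL reduced to a finite range (rh-explicit, D-0040 WEIL column prover seat handoff-prove-2 gen11; D-0059/D-0061 route support)

RH-FREE. Every statement here is an UPPER bound on the wall offsets `δ*(q) = a*(S_q) − (log q)/2` of the finite-place Weil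
forms, or an upper clause `a*(S_q) < (log q')/2`; none implies RH, RH implies none of them
(`HandoffMarginLaw.riemannHypothesis_iff_forall_wallOffset_nonneg` is the RH-EQUIVALENT lower clause, not touched here).
Nothing here bears on the truth of RH.

WHAT IS PROVED (kernel, standard axioms; every ingredient is a tree theorem):
* `dodgerWallCeiling_exp204` — the EXPLICIT instance `DodgerWallCeiling (7/100) ⌈e^{204}⌉`
  (`= dodgerWallCeiling_of_zeroSumFamily subwindowZeroSumFamily_exp204`, HANDOFF track ATTEMPT-16 and ATTEMPT-19);
* `semilocalDodgerCeiling_holds : WeilColumn.SemilocalDodgerCeiling` — the W-P leaf (P1-type) of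
  `WeilColumnCeilings.lean` §5 (ROUTE-PROPOSAL-WeilSemilocal item 4) is a THEOREM: `⟨7/100, ⌈e^{204}⌉, …⟩`;
* `upperClause_from_exp204` — the UPPER CLAUSE `a*(S_q) < (log q⁺)/2` for EVERY prime `q ≥ ⌈e^{204}⌉` (explicit threshold, no `∃`);
* `semilocalClassLawTail_iff_range` — the route's CRUX `SemilocalClassLaw.SemilocalClassLawTail` (C-I(a) for the primes `q ≥ 80`)
  is EQUIVALENT to its restriction to the finite range `80 ≤ q < ⌈e^{204}⌉`: what remains of C-I(a) is a finite (astronomically long)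
  list of per-prime negativity certificates, or a smaller analytic threshold.

References: this cell, HANDOFF track ATTEMPT-15 §5–§6, ATTEMPT-16 THEOREM 16.2, ATTEMPT-19 §8′ (the dodger family);
H. Yoshida, Adv. Stud. Pure Math. 21 (1992) Prop. 6 [`Yoshida1992HermitianForms`] (thresholds); E. Bombieri, Rend. Mat. Acc. Lincei (9) 11
(2000) Thm 2 [`Bombieri2000Weil`] (the explicit formula behind `weilQuadratic`).
-/

set_option linter.dupNamespace false

noncomputable section

open Set Literature.NumberTheory.LFunctions
open Summit.RiemannHypothesis.RiemannHypothesis.Theorems.MotivicDoor.SemilocalThreshold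
open Summit.RiemannHypothesis.RiemannHypothesis.Theorems.HandoffDecomposition (nextPrime nextPrime_prime lt_nextPrime nextPrime_le)
open Summit.RiemannHypothesis.RiemannHypothesis.Theorems.Handoff
open Summit.RiemannHypothesis.RiemannHypothesis.Theorems.SemilocalClassLaw

namespace Summit.RiemannHypothesis.RiemannHypothesis.Theorems.WeilColumn

/-! ## §1  The explicit exponent-3/2 ceiling and the leaf -/

/-- **RH-FREE, explicit.** The Dodger wall ceiling with constant `7/100` from the prime threshold `⌈e^{204}⌉`:
`∀ primes q ≥ ⌈e^{204}⌉, δ*(q) ≤ (7/100)(log q)^{3/2} q^{−3/2}`. [this cell, HANDOFF track ATTEMPT-16 THEOREM 16.2 / ATTEMPT-19 §8′] -/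
theorem dodgerWallCeiling_exp204 : DodgerWallCeiling (7 / 100) ⌈Real.exp 204⌉₊ :=
  dodgerWallCeiling_of_zeroSumFamily subwindowZeroSumFamily_exp204

/-- **THE W-P LEAF (P1-type) IS A THEOREM — RH-FREE.** `SemilocalDodgerCeiling` («some exponent-3/2 ceiling holds for the
semilocal wall offsets») with the witnesses `C = 7/100`, `q₀ = ⌈e^{204}⌉`. [this cell, HANDOFF track ATTEMPT-16 THEOREM 16.2; WEIL column ROUTE-PROPOSAL-WeilSemilocal item 4] -/
theorem semilocalDodgerCeiling_holds : SemilocalDodgerCeiling :=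
  ⟨7 / 100, ⌈Real.exp 204⌉₊, dodgerWallCeiling_exp204⟩

/-- The leaf at the general scale: `WallCeilingAtScale (dodger scale 7/100) ⌈e^{204}⌉`. [bookkeeping] -/
theorem wallCeilingAtScale_dodger_exp204 :
    WallCeilingAtScale (fun q ↦ 7 / 100 * Real.log q ^ (3 / 2 : ℝ) * (q : ℝ) ^ (-(3 / 2 : ℝ))) ⌈Real.exp 204⌉₊ :=
  (dodgerWallCeiling_iff _ _).1 dodgerWallCeiling_exp204

/-! ## §2  The upper clause from an explicit prime, and the crux reduced to a finite range -/

/-- `3 ≤ ⌈e^{204}⌉`. [elementary] -/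
theorem three_le_ceil_exp204 : 3 ≤ ⌈Real.exp 204⌉₊ := by
  have h : (3 : ℝ) ≤ Real.exp 204 := by
    have := Real.add_one_le_exp (204 : ℝ)
    linarith
  exact_mod_cast h.trans (Nat.le_ceil (Real.exp 204))

/-- **RH-FREE, explicit threshold.** The UPPER CLAUSE for every prime `q ≥ ⌈e^{204}⌉`: `a*(S_q) < (log q⁺)/2`, `q⁺` the next prime —
`upperClause_of_zeroSumFamily` at the explicit family (no `∃ q₀`). [this cell, HANDOFF track ATTEMPT-16 COROLLARY 16.3] -/
theorem upperClause_from_exp204 {q : ℕ} (hq : q.Prime) (hq₀ : ⌈Real.exp 204⌉₊ ≤ q) :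
    weilSemilocalThreshold (Nat.primesBelow q) < Real.log (nextPrime q) / 2 :=
  upperClause_of_zeroSumFamily subwindowZeroSumFamily_exp204 (by rw [abs_of_pos (by norm_num : (0:ℝ) < 7 / 100)]) hq hq₀
    (three_le_ceil_exp204.trans hq₀)

/-- **RH-FREE.** C-I(a) at every prime `q ≥ ⌈e^{204}⌉`, in the `∀ q' > q` currency of the leaf. [this cell] -/
theorem classLaw_from_exp204 {q : ℕ} (hq : q.Prime) (hq₀ : ⌈Real.exp 204⌉₊ ≤ q) :
    ∀ q' : ℕ, q'.Prime → q < q' → weilSemilocalThreshold (Nat.primesBelow q) < Real.log q' / 2 :=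
  forall_prime_gt_lt_iff_upperClause.2 (upperClause_from_exp204 hq hq₀)

/-- **THE CRUX REDUCED TO A FINITE RANGE (RH-FREE bookkeeping).** The route's crux `SemilocalClassLawTail` (C-I(a) for all primes
`q ≥ 80`) holds iff it holds for the primes `80 ≤ q < ⌈e^{204}⌉`; beyond that threshold it is the theorem `classLaw_from_exp204`.
[this cell] -/
theorem semilocalClassLawTail_iff_range :
    SemilocalClassLawTail ↔
      ∀ q : ℕ, q.Prime → 80 ≤ q → q < ⌈Real.exp 204⌉₊ →
        ∀ q' : ℕ, q'.Prime → q < q' → weilSemilocalThreshold (Nat.primesBelow q) < Real.log q' / 2 := by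
  refine ⟨fun h q hq h80 _ ↦ h q hq h80, fun h q hq h80 ↦ ?_⟩
  rcases Nat.lt_or_ge q ⌈Real.exp 204⌉₊ with hlt | hge
  · exact h q hq h80 hlt
  · exact classLaw_from_exp204 hq hge

/-- The same in `UC(q)` currency: the tail iff `a*(S_q) < (log q⁺)/2` for the primes `80 ≤ q < ⌈e^{204}⌉`. [this cell] -/
theorem semilocalClassLawTail_iff_upperClause_range :
    SemilocalClassLawTail ↔
      ∀ q : ℕ, q.Prime → 80 ≤ q → q < ⌈Real.exp 204⌉₊ →
        weilSemilocalThreshold (Nat.primesBelow q) < Real.log (nextPrime q) / 2 := by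
  rw [semilocalClassLawTail_iff_range]
  exact forall₄_congr fun _ _ _ _ ↦ forall_prime_gt_lt_iff_upperClause

/-- **The whole leaf reduced likewise**: `SemilocalClassLawAll` iff the upper clause at every prime `q < ⌈e^{204}⌉` (the head `q < 80`
is the kernel theorem `semilocalClassLawBelow_eighty` of `SemilocalClassLaw.lean`, not imported here to stay off the build lane).
[this cell] -/
theorem semilocalClassLawAll_iff_upperClause_range :
    SemilocalClassLawAll ↔
      ∀ q : ℕ, q.Prime → q < ⌈Real.exp 204⌉₊ →
        weilSemilocalThreshold (Nat.primesBelow q) < Real.log (nextPrime q) / 2 := by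
  rw [semilocalClassLawAll_iff_forall_upperClause]
  refine ⟨fun h q hq _ ↦ h q hq, fun h q hq ↦ ?_⟩
  rcases Nat.lt_or_ge q ⌈Real.exp 204⌉₊ with hlt | hge
  · exact h q hq hlt
  · exact upperClause_from_exp204 hq hge

end Summit.RiemannHypothesis.RiemannHypothesis.Theorems.WeilColumn

end
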